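import Summits.CriticalPhenomena.PercolationContinuityZ3.Theorems.PercNearOneGluingNoHeavyLowerTailThreePointCPIClusterSwap
import HarnessLib

/-!
# The flat `♭` in the fibre language: injectivity and the two-point bound `V ≤ min(Cn, Dn)`, `V² ≤ Cn·Dn`
# (Sahi programme, prover prim-sahi-p2 gen 54)

Support file (`--supports stmt-CriticalPhenomena-4575`, helper); companion of `…ThreePointProductFormFibreAdjacent` (same gen).  Standard axioms,
no sorries, no named facts, no definitions (statements spelled out with `Finset.filter` in the vocabulary of
`Literature/Probability/Percolation/ComplementPatternCounts.lean` and `…ThreePointCPIClusterSwapDefs`).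
Memo `run/shared/lean/prim/prim-sahi/FROM-prim-sahi-p2-gen54-CERTIFICATE-SHAPE.md`; gen 53 memo §2 (the cut-vertex theorem) and (63n).

The FLAT of the fibre language (gens 44–54: `♭T = T △ Ē(C_a T)`, complement every label touching the open cluster of the apex `a`) is, for a
labelled configuration `z : α → Bool`, the configuration `clusterFlip ends a (fun l => !z l)`: the cluster flip `μ_a` of the facecert lane
(`…ThreePointCPIClusterSwapDefs`) applied to the complement `z̄` (the closed cluster of `a` in `z̄` is the open cluster of `a` in `z`; `μ_a`
keeps `z̄` on the labels touching it and complements `z̄` back to `z` elsewhere).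
* **`flat_injective`** [this work] — `z ↦ ♭z` is injective (`μ_a` is an involution, `clusterFlip_clusterFlip`, and so is complementation).
* **`card_virtual_le_card_conn`**, **`card_virtual_le_card_disc`**, **`virtual_sq_le_conn_mul_disc`** [this work] — the TWO-POINT FACT of the
  cut-vertex theorem (gen 53 §2): with `V = #{z : a ↮ t in z, a ↔ t in ♭z}` ('virtually joined'), `Cn = #{a ↔ t}`, `Dn = #{a ↮ t}`:
  `V ≤ Cn` (♭ is injective and lands in `{a ↔ t}`), `V ≤ Dn` (inclusion), hence `V² ≤ Cn · Dn` — the 2×2 matrix `[[Cn, V],[V, Dn]]` is PSD,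
  whose Schur/Hadamard square is the cut-vertex case of CONJECTURE (P).
* **`card_bad_le_card_conn`** [this work] — three points: `#bad ≤ #{z : s ↔ c in z}` (`bad = {a|s|c in z, s ↔ c in ♭z}`; ♭ injective).
[folklore] (involutions are injective; `Finset.card_le_card_of_injOn`); [cite: Gladkov2024, Conjecture 10.1 (p. 18), arXiv:2408.08457] for (P).
-/

namespace Summit.CriticalPhenomena.PercolationContinuityZ3.Theorems.ProductFormFibre

open Finset Literature.Probability.Percolation
open Summit.CriticalPhenomena.PercolationContinuityZ3.Theorems.ThreePointCPIClusterSwap (clusterFlip clusterFlip_clusterFlip)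

variable {V α : Type*}

/-! ### 1. The flat is injective -/

/-- Complementation of labelled configurations is injective. [folklore] -/
theorem compl_injective' : Function.Injective (fun z : α → Bool => fun l => !z l) := by
  intro z₁ z₂ h
  funext l
  have := congrArg (fun w : α → Bool => w l) h
  simpa using this

/-- **The flat `♭z = μ_a(z̄)` is injective** (`μ_a` is an involution). [this work] -/
theorem flat_injective (ends : α → Sym2 V) (a : V) :
    Function.Injective (fun z : α → Bool => clusterFlip ends a (fun l => !z l)) := by
  classical
  intro z₁ z₂ h
  have h' : (fun l => !z₁ l) = (fun l => !z₂ l) := by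
    have := congrArg (clusterFlip ends a) h
    simpa only [clusterFlip_clusterFlip] using this
  exact compl_injective' h'

/-! ### 2. The two-point bound -/

section Counts

variable [Fintype α] [DecidableEq α]

open Classical in
/-- **`V ≤ Cn`**: the configurations in which `a ↮ t` but `a ↔ t` after the flat are at most as many as those with `a ↔ t`
(the flat is injective and lands in `{a ↔ t}`). [this work] -/
theorem card_virtual_le_card_conn (ends : α → Sym2 V) (a t : V) :
    (univ.filter fun z : α → Bool =>
        ¬ (openGraph (labelledOpen ends z)).Reachable a t ∧
        (openGraph (labelledOpen ends (clusterFlip ends a fun l => !z l))).Reachable a t).card ≤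
    (univ.filter fun z : α → Bool => (openGraph (labelledOpen ends z)).Reachable a t).card := by
  refine Finset.card_le_card_of_injOn (fun z => clusterFlip ends a fun l => !z l) ?_ ?_
  · intro z hz
    rw [Finset.mem_coe, Finset.mem_filter] at hz ⊢
    exact ⟨Finset.mem_univ _, hz.2.2⟩
  · intro z₁ _ z₂ _ h
    exact flat_injective ends a h

open Classical in
/-- **`V ≤ Dn`** (inclusion). [this work] -/
theorem card_virtual_le_card_disc (ends : α → Sym2 V) (a t : V) :
    (univ.filter fun z : α → Bool =>
        ¬ (openGraph (labelledOpen ends z)).Reachable a t ∧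
        (openGraph (labelledOpen ends (clusterFlip ends a fun l => !z l))).Reachable a t).card ≤
    (univ.filter fun z : α → Bool => ¬ (openGraph (labelledOpen ends z)).Reachable a t).card := by
  refine Finset.card_le_card ?_
  intro z hz
  rw [Finset.mem_filter] at hz ⊢
  exact ⟨hz.1, hz.2.1⟩

open Classical in
/-- **THE TWO-POINT FACT `V² ≤ Cn · Dn`** (the 2×2 matrix `[[Cn, V],[V, Dn]]` is positive semidefinite); its Hadamard square across a cut
vertex is the cut-vertex case of CONJECTURE (P) (gen 53 memo §2). [this work] -/
theorem virtual_sq_le_conn_mul_disc (ends : α → Sym2 V) (a t : V) :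
    (univ.filter fun z : α → Bool =>
        ¬ (openGraph (labelledOpen ends z)).Reachable a t ∧
        (openGraph (labelledOpen ends (clusterFlip ends a fun l => !z l))).Reachable a t).card ^ 2 ≤
    (univ.filter fun z : α → Bool => (openGraph (labelledOpen ends z)).Reachable a t).card *
    (univ.filter fun z : α → Bool => ¬ (openGraph (labelledOpen ends z)).Reachable a t).card := by
  rw [sq]
  exact Nat.mul_le_mul (card_virtual_le_card_conn ends a t) (card_virtual_le_card_disc ends a t)

open Classical in
/-- **Three points: `#bad ≤ #{s ↔ c}`.**  The bad configurations (`a, s, c` pairwise separated in `z`, `s ↔ c` in `♭z`) are at most as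
many as the configurations with `s ↔ c` (♭ injective). [this work] -/
theorem card_bad_le_card_conn (ends : α → Sym2 V) (a s c : V) :
    (univ.filter fun z : α → Bool =>
        (¬ (openGraph (labelledOpen ends z)).Reachable a s ∧ ¬ (openGraph (labelledOpen ends z)).Reachable a c ∧
          ¬ (openGraph (labelledOpen ends z)).Reachable s c) ∧
        (openGraph (labelledOpen ends (clusterFlip ends a fun l => !z l))).Reachable s c).card ≤
    (univ.filter fun z : α → Bool => (openGraph (labelledOpen ends z)).Reachable s c).card := by
  refine Finset.card_le_card_of_injOn (fun z => clusterFlip ends a fun l => !z l) ?_ ?_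
  · intro z hz
    rw [Finset.mem_coe, Finset.mem_filter] at hz ⊢
    exact ⟨Finset.mem_univ _, hz.2.2⟩
  · intro z₁ _ z₂ _ h
    exact flat_injective ends a h

end Counts

end Summit.CriticalPhenomena.PercolationContinuityZ3.Theorems.ProductFormFibre
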